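import Summits.QuantumFields.YangMills.Theorems.BalabanUVNodesN13U1StepMajorantTowerAtRecord13CoPH
import Summits.QuantumFields.YangMills.Theorems.BalabanUVNodesN13EndStatementBOfTRowAndPieceBoundsAtRecord13SepCoPH

/-!
# BalabanUVNodes ∕ N13 — THE ENGINE ROW `hUV`, [III] COR. 3 AT THE RECORD, K1⁷'s (B) AT ITS LITERAL DATUM AND N13's DAG NODE FROM THE PER-STEP ROWS OF THE MAJORANT TOWER
# (p607601) + (L2ˢ): the k → k+1 carving CONSUMED toward the key item (Track A, DAG node N13 = [B16]; cluster K1 — K1⁷ `StabilityBAtRecordR13SepCoPH` = stmt-QuantumFields-20542,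
# helper; seat `pub-ymgap-dag-n13-w3` g3; the per-step twin of g2's F3 `…N13EndStatementBOfTRowAndPieceBoundsAtRecord13SepCoPH` (p604459); 2026-08-28; count-neutral)

HONEST FRAMING.  Count-neutral BY-NAME JUNCTION; nothing of Bałaban's is asserted.  g2's F3 priced N13's node and K1⁷'s (B) at the literal datum by ONE level-`k` estimate (U1_Z) + (L2ˢ); p607601
carved (U1) along the slot recursion into PER-STEP ROWS (tower: base `ρ₀` DISCHARGED, `w`-rows = `Provisos₁₃CoPH.tstep`, 𝐑-ratio row, step rows).  THIS FILE substitutes the carving into F3's statements: (§1) the engines' row `hUV` at the Co datum (dag-n24-c's `WorldP` letters) ⟸ per-run per-step data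
`x_P, y_P ≥ 0`, rates `a_P` with base `−E(P) ≤ a_P(0)`, 𝐑-ratio moduli `c_R ≥ 0` with the 𝐑-ratio rows, the PRODUCT-SHAPE STEP ROWS «`χ_{j+1}(s′)(V′)·c_R(s′)(V′)·T_j(|w_j(s′)(·,V′)|)(V′)·
e^{a_P(j)} ≤ e^{a_P(j+1)}·x_P(j+1)^{#⊄Ω_{j+1}(s′)}·y_P(j+1)^{#⊄Λ_{j+1}(s′)}`» for `j < K` on the windowed runs, the numeric clause `a_P(k) + Σ_{j≤k}(x_P(j)+y_P(j))|I_j| ≤ ep(g_k)|T₁^{(k)}|`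
(F2's located demand `|I_j| ≈ L^{4(k−j)}|T₁^{(k)}|∕(MR_j)⁴`), and (L2ˢ) + dag-n13-w1's `hε hε3 hε2` (`hUV₁₃CoPH_of_productStepRows_L2small`, through p595529's
`hUV₁₃_of_upper_of_lowerSmallLocus` and p607601's `densOfRecord₁₃_le_of_productStepRows`); (§2) [III] Cor. 3 «with e±» ∕ `Cor3_250` at the Co datum from Theorem 1's conclusion resp.
Theorem 1 at the record; (§3) K1⁷'s (B) `B16.EndStatementBPrinted ((datumOfRecord₁₃SepCoPH θ h).C)` from Theorem 1 there, and from N11's T-row + the [IV] p.177 selector laws (p583899);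
(§4) N13's DAG NODE `Dag.B16_main (leavesP w P)` — the N13 conjunct of K1⁷ v6 stub 1's `Nodes` — from the selector laws + the per-step rows + (L2ˢ): after g3, N13's node is priced BY NAME down to
the base weight `ρ₀` (discharged), PER-STEP transported-step-weight × 𝐑-ratio rows ([III] §3 ∕ (2.49) first term, [IV] §1, [B16] (1.89) — DISPLAYED, LOCATED, nobody's theorem here; `x = y = 1` the
plain sup instance, the small factors living in a field-dependent tower per p607601 §2), (L2ˢ) and the selector laws.  VERSION CAVEAT (def-T FILE 1) inherited.  (U1) NOT proved; Cor. 3 NOT proved;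
N13 NOT discharged; K0⁷ ∕ K1⁷ NOT closed; counts unmoved (discharged 5∕27 · Track A 5∕28).  ONE finite four-torus programme at fixed `ε = L^{−K}`; R4 closes the conditional finite-𝕋⁴ rung
`BalabanLadder.UV` only — the Yang–Mills mass gap (Clay) is NOT proved by any of this; nothing continuum ∕ ℝ⁴ ∕ OS.  No `sorry`, `def`, `instance`, `notation`.

Sources: [Balaban1988Convergent] p.245, p.257, p.262, p.264, p.270; [Balaban1989LargeFieldI] p.176–177; [Balaban1989LargeFieldII] pp.355–356, p.387, p.391.
-/

noncomputable section

open MeasureTheory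
open scoped BigOperators Matrix.Norms.L2Operator

namespace Summit.QuantumFields.YangMills.BalabanUVNodes.N13NodeOfProductStepRowsAtRecord13SepCoPH

open Literature.MathematicalPhysics.QuantumFieldTheory.Balaban1983to89
open T4Continuum Node00 B14.Eq218Concrete
open FlowStepRuns (genFlow)
open DagBinding (WorldP)
open ExpMeanLog (deltaSU)
open B16NodeKnitRecord13CoPH (uvIneq_at_record₁₃CoPH_iff)
open B14Cor3 (inInterval_of_le)
open B16RLeafRecord13SepCoPHSelLaws (thm1Printed_datumOfRecord₁₃SepCoPH_of_laws_of_selLaws)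
open Summit.QuantumFields.YangMills.BalabanUVNodes.N13Cor3Repr218LeavesAtRecord13CoPH (densOfRecord₁₃_eq_sum sLaw₁₃CoPH_of_thm1)
open Summit.QuantumFields.YangMills.BalabanUVNodes.N13UVChiOffSolvableAtRecord13 (histTerm_nonneg uvLower_of_smallLocus)
open Summit.QuantumFields.YangMills.BalabanUVNodes.N13UVRowOfUpperAndSmallLocus (hUV₁₃_of_upper_of_lowerSmallLocus)
open Summit.QuantumFields.YangMills.BalabanUVNodes.N13U1StepMajorantTowerAtRecord13CoPH (densOfRecord₁₃_le_of_productStepRows)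

variable (F : T4Family) (N : ℕ) [NeZero N]

/-! ## §1. The engines' row `hUV` at the record from the PER-STEP PRODUCT ROWS of the majorant tower + (L2ˢ) -/

section Row

variable (θ : Stage13HParams F N) (w : WorldP)

open Classical in
/-- **★★★ THE ENGINE ROW `hUV` FROM PER-STEP ROWS + (L2ˢ)** (the per-step twin of F3's `hUV₁₃CoPH_of_pieceBounds_L2small`; shape of module 36's `hUV13`, `WorldP` letters `w.γ w.em w.ep`):
UPPER half at every configuration from p607601's majorant tower in the product shape (`densOfRecord₁₃_le_of_productStepRows`: base `−E(P) ≤ a_P(0)` — `ρ₀` discharged —, the 𝐑-ratio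
rows, the PRODUCT-SHAPE STEP ROWS for `j < K` on the windowed runs, the numeric clause against `w.ep(g_k)|T₁^{(k)}|`), LOWER half from (L2ˢ) at small configurations extended by dag-n13-w1's
`uvLower_of_smallLocus` (inside `hUV₁₃_of_upper_of_lowerSmallLocus`).  CONDITIONAL on the displayed rows ([III] §3 ∕ (2.49), [IV] §1, [B16] (1.89) — nobody's theorem here); nothing of
Bałaban's asserted. [cite: Balaban1988Convergent, (2.49) + Cor. 3 (2.50) p.264, (3.25) p.270; Balaban1989LargeFieldI, (0.3) p.176; Balaban1989LargeFieldII, (0.1) pp.355–356, (1.89) p.387] -/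
theorem hUV₁₃CoPH_of_productStepRows_L2small (h : θ.Provisos₁₃CoPH F N) (hε : 0 < θ.ν.εreg) (hε3 : (143 * ((((4 + 4 : ℕ) : ℝ)) ^ 2 / 4) ^ 2) * θ.ν.εreg ≤ 1 / 3)
    (hε2 : 2 * θ.ν.εreg ≤ 2 * deltaSU (Fin N) / ((((4 + 4) * F.L : ℕ) : ℝ) ^ 2))
    (x y a : B12.RunParams → ℕ → ℝ) (hx : ∀ P j, 0 ≤ x P j) (hy : ∀ P j, 0 ≤ y P j)
    (cR : (P : B12.RunParams) → (j : ℕ) → SeqOfRecord F θ.ν θ.τ9.M (gOfRecord₁₃ F N θ.toStage13Params P) P.K j → GaugeField (F.P P.K) j (SU N) → ℝ)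
    (h0 : ∀ P : B12.RunParams, -EOfRecord₁₃ F N θ.toStage13Params P ≤ a P 0)
    (hcR : ∀ (P : B12.RunParams) j, j < P.K → ∀ (s' : SeqOfRecord F θ.ν θ.τ9.M (gOfRecord₁₃ F N θ.toStage13Params P) P.K (j + 1)) V', 0 ≤ cR P (j + 1) s' V')
    (hR : ∀ (P : B12.RunParams) j, j < P.K → ∀ (s' : SeqOfRecord F θ.ν θ.τ9.M (gOfRecord₁₃ F N θ.toStage13Params P) P.K (j + 1)) V',
      |slotsOfRecord F N θ.ν θ.τ9 (EOfRecord₁₃ F N θ.toStage13Params) (wOfRecord₉ F N θ.toStage9Params) θ.ppSel P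
          (gOfRecord₁₃ F N θ.toStage13Params P) (j + 1) s' V'| ≤
        cR P (j + 1) s' V' * |slotsTOfRecord F N θ.ν θ.τ9 (EOfRecord₁₃ F N θ.toStage13Params) (wOfRecord₉ F N θ.toStage9Params) θ.ppSel P
          (gOfRecord₁₃ F N θ.toStage13Params P) (j + 1) s' V'|)
    (hstep : ∀ P : B12.RunParams, (genFlow (betaOfRecord₁₃ F N θ.toStage13Params) P.g0).InInterval w.γ P.K → ∀ j, j < P.K →
      ∀ (s' : SeqOfRecord F θ.ν θ.τ9.M (gOfRecord₁₃ F N θ.toStage13Params P) P.K (j + 1)) V',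
      chiSeqOfRecord F N θ.ν θ.τ9.M (gOfRecord₁₃ F N θ.toStage13Params P) P.K (j + 1) s' V' * cR P (j + 1) s' V' *
          transportOfRecord F N P.K j (fun U => |wOfRecord₉ F N θ.toStage9Params P (gOfRecord₁₃ F N θ.toStage13Params P) j s' U V'|) V' *
          Real.exp (a P j) ≤
        Real.exp (a P (j + 1)) *
          (x P (j + 1) ^ Set.ncard {c | c ∈ cubeIndices (F.P P.K) (dCubeSide (F.P P.K).L θ.τ9.M
              (RkOfRecord (F.P P.K).L θ.ν.r (gOfRecord₁₃ F N θ.toStage13Params P (j + 1))) (j + 1)) ∧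
            ¬ cubeEnl (F.P P.K) (dCubeSide (F.P P.K).L θ.τ9.M (RkOfRecord (F.P P.K).L θ.ν.r (gOfRecord₁₃ F N θ.toStage13Params P (j + 1))) (j + 1)) c 0 ⊆ s'.Ω (j + 1)} *
           y P (j + 1) ^ Set.ncard {c | c ∈ cubeIndices (F.P P.K) (dCubeSide (F.P P.K).L θ.τ9.M
              (RkOfRecord (F.P P.K).L θ.ν.r (gOfRecord₁₃ F N θ.toStage13Params P (j + 1))) (j + 1)) ∧
            ¬ cubeEnl (F.P P.K) (dCubeSide (F.P P.K).L θ.τ9.M (RkOfRecord (F.P P.K).L θ.ν.r (gOfRecord₁₃ F N θ.toStage13Params P (j + 1))) (j + 1)) c 0 ⊆ s'.Λ (j + 1)}))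
    (hnum : ∀ P : B12.RunParams, (genFlow (betaOfRecord₁₃ F N θ.toStage13Params) P.g0).InInterval w.γ P.K → ∀ k, k ≤ P.K →
      a P k + ∑ j ∈ Finset.Icc 1 k, (x P j + y P j) *
          (cubeIndices (F.P P.K) (dCubeSide (F.P P.K).L θ.τ9.M (RkOfRecord (F.P P.K).L θ.ν.r (gOfRecord₁₃ F N θ.toStage13Params P j)) j)).card
        ≤ w.ep (gOfRecord₁₃ F N θ.toStage13Params P k) * (Fintype.card (Site (F.P P.K) k) : ℝ))
    (s₀ : (P : B12.RunParams) → (k : ℕ) → (reprOfRecord₁₃ F N θ.toStage13Params P k).Adm)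
    (hL2small : ∀ P : B12.RunParams, (genFlow (betaOfRecord₁₃ F N θ.toStage13Params) P.g0).InInterval w.γ P.K → ∀ k, k ≤ P.K → SLaw₁₃CoPH F N θ P k →
      ∀ V : GaugeField (F.P P.K) k (SU N),
        (∀ p : Plaq (F.P P.K) k, ¬ IsB0 (F := F) (⟨p.src, p.μ⟩ : PBond (F.P P.K) k) → ¬ IsB0 (F := F) (⟨p.src.shift p.μ, p.ν⟩ : PBond (F.P P.K) k) →
          ¬ IsB0 (F := F) (⟨p.src.shift p.ν, p.μ⟩ : PBond (F.P P.K) k) → ¬ IsB0 (F := F) (⟨p.src, p.ν⟩ : PBond (F.P P.K) k) →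
          dist1 (GaugeField.plaqHol V p) < 2 * θ.ν.εreg + 4 * θ.ε₂₉) →
        chiβOfRecord₁₃ F N θ.toStage13Params P.K (gOfRecord₁₃ F N θ.toStage13Params P) k V *
            Real.exp (-(1 / (gOfRecord₁₃ F N θ.toStage13Params P k) ^ 2 * wilsonBGOfRecord F N θ.εbg P k V)
              - w.em (gOfRecord₁₃ F N θ.toStage13Params P k) * (Fintype.card (Site (F.P P.K) k) : ℝ)) ≤
          (reprOfRecord₁₃ F N θ.toStage13Params P k).χ (s₀ P k) V * (reprOfRecord₁₃ F N θ.toStage13Params P k).TexpA (s₀ P k) V) :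
    ∀ P : B12.RunParams, (genFlow (betaOfRecord₁₃ F N θ.toStage13Params) P.g0).InInterval w.γ P.K → ∀ k, k ≤ P.K → SLaw₁₃CoPH F N θ P k →
      ∀ U : GaugeField (F.P P.K) k (SU N),
        chiβOfRecord₁₃ F N θ.toStage13Params P.K (gOfRecord₁₃ F N θ.toStage13Params P) k U *
              Real.exp (-(1 / (gOfRecord₁₃ F N θ.toStage13Params P k) ^ 2 * wilsonBGOfRecord F N θ.toStage13Params.εbg P k U)
                - w.em (gOfRecord₁₃ F N θ.toStage13Params P k) * (Fintype.card (Site (F.P P.K) k) : ℝ)) ≤ densOfRecord₁₃ F N θ.toStage13Params P k U ∧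
        densOfRecord₁₃ F N θ.toStage13Params P k U ≤ Real.exp (w.ep (gOfRecord₁₃ F N θ.toStage13Params P k) * (Fintype.card (Site (F.P P.K) k) : ℝ)) :=
  hUV₁₃_of_upper_of_lowerSmallLocus θ h w hε hε3 hε2
    (fun P hP k hk _ U => densOfRecord₁₃_le_of_productStepRows F N θ P h k hk (hx P) (hy P) (a P) _ (cR P) (h0 P)
      (fun j hj => hcR P j (lt_of_lt_of_le hj hk)) (fun j hj => hR P j (lt_of_lt_of_le hj hk)) (fun j hj => hstep P hP j (lt_of_lt_of_le hj hk))
      (hnum P hP k hk) U)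
    (fun P hP k hk hS U hsmall =>
      B14Cor3.ge_of_sum_repr
        (fun s => (reprOfRecord₁₃ F N θ.toStage13Params P k).χ s U * (reprOfRecord₁₃ F N θ.toStage13Params P k).TexpA s U) (s₀ P k)
        (densOfRecord₁₃_eq_sum F N θ P k U) (fun s => histTerm_nonneg θ.toStage13Params h.zetaUnity h.zetaAbs P k s U) (hL2small P hP k hk hS U hsmall))

end Row

/-! ## §2. [III] Cor 3 at the Co datum from Theorem 1's conclusion + per-step rows + (L2ˢ) -/

section Family

variable (θ : Stage13HParams F N) (h : θ.Provisos₁₃CoPH F N)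

open Classical in
/-- **★★ [III] COR. 3 «WITH e±» AT THE RECORD FROM THEOREM 1's CONCLUSION + PER-STEP ROWS + (L2ˢ)** (the per-step twin of F3's `cor3With_datumOfRecord₁₃CoPH_of_pieceBounds_L2small`): at every
windowed run and every `k ≤ K` with `SLaw₁₃CoPH θ P k`, `B16.UVIneq … V (em g_k) (ep g_k)` at EVERY configuration — upper half from the tower's product rows (p607601), lower half from (L2ˢ)
via `uvLower_of_smallLocus`.  CONDITIONAL on `hS`, the displayed rows, (L2ˢ); nothing of Bałaban's asserted. [cite: Balaban1988Convergent, Thm 1 p.262, (2.49) + Cor. 3 (2.50) p.264; Balaban1989LargeFieldI, (0.3) p.176] -/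
theorem cor3With_datumOfRecord₁₃CoPH_of_productStepRows_L2small (hε : 0 < θ.ν.εreg) (hε3 : (143 * ((((4 + 4 : ℕ) : ℝ)) ^ 2 / 4) ^ 2) * θ.ν.εreg ≤ 1 / 3)
    (hε2 : 2 * θ.ν.εreg ≤ 2 * deltaSU (Fin N) / ((((4 + 4) * F.L : ℕ) : ℝ) ^ 2)) (γ : ℝ) (em ep : ℝ → ℝ)
    (x y a : B12.RunParams → ℕ → ℝ) (hx : ∀ P j, 0 ≤ x P j) (hy : ∀ P j, 0 ≤ y P j)
    (cR : (P : B12.RunParams) → (j : ℕ) → SeqOfRecord F θ.ν θ.τ9.M (gOfRecord₁₃ F N θ.toStage13Params P) P.K j → GaugeField (F.P P.K) j (SU N) → ℝ)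
    (h0 : ∀ P : B12.RunParams, -EOfRecord₁₃ F N θ.toStage13Params P ≤ a P 0)
    (hcR : ∀ (P : B12.RunParams) j, j < P.K → ∀ (s' : SeqOfRecord F θ.ν θ.τ9.M (gOfRecord₁₃ F N θ.toStage13Params P) P.K (j + 1)) V', 0 ≤ cR P (j + 1) s' V')
    (hR : ∀ (P : B12.RunParams) j, j < P.K → ∀ (s' : SeqOfRecord F θ.ν θ.τ9.M (gOfRecord₁₃ F N θ.toStage13Params P) P.K (j + 1)) V',
      |slotsOfRecord F N θ.ν θ.τ9 (EOfRecord₁₃ F N θ.toStage13Params) (wOfRecord₉ F N θ.toStage9Params) θ.ppSel P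
          (gOfRecord₁₃ F N θ.toStage13Params P) (j + 1) s' V'| ≤
        cR P (j + 1) s' V' * |slotsTOfRecord F N θ.ν θ.τ9 (EOfRecord₁₃ F N θ.toStage13Params) (wOfRecord₉ F N θ.toStage9Params) θ.ppSel P
          (gOfRecord₁₃ F N θ.toStage13Params P) (j + 1) s' V'|)
    (hstep : ∀ P : B12.RunParams, ((datumOfRecord₁₃CoPH F N θ h).C P).flow.InInterval γ P.K → ∀ j, j < P.K →
      ∀ (s' : SeqOfRecord F θ.ν θ.τ9.M (gOfRecord₁₃ F N θ.toStage13Params P) P.K (j + 1)) V',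
      chiSeqOfRecord F N θ.ν θ.τ9.M (gOfRecord₁₃ F N θ.toStage13Params P) P.K (j + 1) s' V' * cR P (j + 1) s' V' *
          transportOfRecord F N P.K j (fun U => |wOfRecord₉ F N θ.toStage9Params P (gOfRecord₁₃ F N θ.toStage13Params P) j s' U V'|) V' *
          Real.exp (a P j) ≤
        Real.exp (a P (j + 1)) *
          (x P (j + 1) ^ Set.ncard {c | c ∈ cubeIndices (F.P P.K) (dCubeSide (F.P P.K).L θ.τ9.M
              (RkOfRecord (F.P P.K).L θ.ν.r (gOfRecord₁₃ F N θ.toStage13Params P (j + 1))) (j + 1)) ∧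
            ¬ cubeEnl (F.P P.K) (dCubeSide (F.P P.K).L θ.τ9.M (RkOfRecord (F.P P.K).L θ.ν.r (gOfRecord₁₃ F N θ.toStage13Params P (j + 1))) (j + 1)) c 0 ⊆ s'.Ω (j + 1)} *
           y P (j + 1) ^ Set.ncard {c | c ∈ cubeIndices (F.P P.K) (dCubeSide (F.P P.K).L θ.τ9.M
              (RkOfRecord (F.P P.K).L θ.ν.r (gOfRecord₁₃ F N θ.toStage13Params P (j + 1))) (j + 1)) ∧
            ¬ cubeEnl (F.P P.K) (dCubeSide (F.P P.K).L θ.τ9.M (RkOfRecord (F.P P.K).L θ.ν.r (gOfRecord₁₃ F N θ.toStage13Params P (j + 1))) (j + 1)) c 0 ⊆ s'.Λ (j + 1)}))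
    (hnum : ∀ P : B12.RunParams, ((datumOfRecord₁₃CoPH F N θ h).C P).flow.InInterval γ P.K → ∀ k, k ≤ P.K →
      a P k + ∑ j ∈ Finset.Icc 1 k, (x P j + y P j) *
          (cubeIndices (F.P P.K) (dCubeSide (F.P P.K).L θ.τ9.M (RkOfRecord (F.P P.K).L θ.ν.r (gOfRecord₁₃ F N θ.toStage13Params P j)) j)).card
        ≤ ep (gOfRecord₁₃ F N θ.toStage13Params P k) * (Fintype.card (Site (F.P P.K) k) : ℝ))
    (s₀ : (P : B12.RunParams) → (k : ℕ) → (reprOfRecord₁₃ F N θ.toStage13Params P k).Adm)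
    (hS : ∀ P : B12.RunParams, ((datumOfRecord₁₃CoPH F N θ h).C P).flow.InInterval γ P.K → ∀ k, k ≤ P.K → SLaw₁₃CoPH F N θ P k)
    (hL2small : ∀ P : B12.RunParams, ((datumOfRecord₁₃CoPH F N θ h).C P).flow.InInterval γ P.K → ∀ k, k ≤ P.K → SLaw₁₃CoPH F N θ P k →
      ∀ V : GaugeField (F.P P.K) k (SU N),
        (∀ p : Plaq (F.P P.K) k, ¬ IsB0 (F := F) (⟨p.src, p.μ⟩ : PBond (F.P P.K) k) → ¬ IsB0 (F := F) (⟨p.src.shift p.μ, p.ν⟩ : PBond (F.P P.K) k) →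
          ¬ IsB0 (F := F) (⟨p.src.shift p.ν, p.μ⟩ : PBond (F.P P.K) k) → ¬ IsB0 (F := F) (⟨p.src, p.ν⟩ : PBond (F.P P.K) k) →
          dist1 (GaugeField.plaqHol V p) < 2 * θ.ν.εreg + 4 * θ.ε₂₉) →
        chiβOfRecord₁₃ F N θ.toStage13Params P.K (gOfRecord₁₃ F N θ.toStage13Params P) k V *
            Real.exp (-(1 / (gOfRecord₁₃ F N θ.toStage13Params P k) ^ 2 * wilsonBGOfRecord F N θ.εbg P k V)
              - em (gOfRecord₁₃ F N θ.toStage13Params P k) * (Fintype.card (Site (F.P P.K) k) : ℝ)) ≤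
          (reprOfRecord₁₃ F N θ.toStage13Params P k).χ (s₀ P k) V * (reprOfRecord₁₃ F N θ.toStage13Params P k).TexpA (s₀ P k) V) :
    B16.Cor3With (datumOfRecord₁₃CoPH F N θ h).C γ em ep := by
  intro P hP k hk V
  have hs : SLaw₁₃CoPH F N θ P k := hS P hP k hk
  have hk' : k ≤ (F.P P.K).m + (F.P P.K).K := hk.trans (Nat.le_add_left _ _)
  refine (uvIneq_at_record₁₃CoPH_iff F N θ h P k V _ _).2 ⟨?_, ?_⟩
  · exact uvLower_of_smallLocus θ.toStage13Params h.zetaUnity h.zetaAbs hε P hk' hε3 hε2 _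
      (fun U hsmall => B14Cor3.ge_of_sum_repr
        (fun s => (reprOfRecord₁₃ F N θ.toStage13Params P k).χ s U * (reprOfRecord₁₃ F N θ.toStage13Params P k).TexpA s U) (s₀ P k)
        (densOfRecord₁₃_eq_sum F N θ P k U) (fun s => histTerm_nonneg θ.toStage13Params h.zetaUnity h.zetaAbs P k s U) (hL2small P hP k hk hs U hsmall)) V
  · exact densOfRecord₁₃_le_of_productStepRows F N θ P h k hk (hx P) (hy P) (a P) _ (cR P) (h0 P)
      (fun j hj => hcR P j (lt_of_lt_of_le hj hk)) (fun j hj => hR P j (lt_of_lt_of_le hj hk)) (fun j hj => hstep P hP j (lt_of_lt_of_le hj hk))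
      (hnum P hP k hk) V

open Classical in
/-- **★★ [III] COR. 3 (`B16.Cor3_250`) AT THE RECORD FROM THEOREM 1 AT THE RECORD + PER-STEP ROWS + (L2ˢ) ON `]0, γ]`** (`min γ γ₁` through `sLaw₁₃CoPH_of_thm1`). CONDITIONAL. [cite: Balaban1988Convergent, Cor. 3 (2.50) p.264; Balaban1989LargeFieldII, Thm 1 p.355] -/
theorem cor3_250_datumOfRecord₁₃CoPH_of_thm1_of_productStepRows_L2small (hε : 0 < θ.ν.εreg) (hε3 : (143 * ((((4 + 4 : ℕ) : ℝ)) ^ 2 / 4) ^ 2) * θ.ν.εreg ≤ 1 / 3)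
    (hε2 : 2 * θ.ν.εreg ≤ 2 * deltaSU (Fin N) / ((((4 + 4) * F.L : ℕ) : ℝ) ^ 2)) (γ : ℝ) (hγ : 0 < γ) (em ep : ℝ → ℝ)
    (x y a : B12.RunParams → ℕ → ℝ) (hx : ∀ P j, 0 ≤ x P j) (hy : ∀ P j, 0 ≤ y P j)
    (cR : (P : B12.RunParams) → (j : ℕ) → SeqOfRecord F θ.ν θ.τ9.M (gOfRecord₁₃ F N θ.toStage13Params P) P.K j → GaugeField (F.P P.K) j (SU N) → ℝ)
    (h0 : ∀ P : B12.RunParams, -EOfRecord₁₃ F N θ.toStage13Params P ≤ a P 0)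
    (hcR : ∀ (P : B12.RunParams) j, j < P.K → ∀ (s' : SeqOfRecord F θ.ν θ.τ9.M (gOfRecord₁₃ F N θ.toStage13Params P) P.K (j + 1)) V', 0 ≤ cR P (j + 1) s' V')
    (hR : ∀ (P : B12.RunParams) j, j < P.K → ∀ (s' : SeqOfRecord F θ.ν θ.τ9.M (gOfRecord₁₃ F N θ.toStage13Params P) P.K (j + 1)) V',
      |slotsOfRecord F N θ.ν θ.τ9 (EOfRecord₁₃ F N θ.toStage13Params) (wOfRecord₉ F N θ.toStage9Params) θ.ppSel P
          (gOfRecord₁₃ F N θ.toStage13Params P) (j + 1) s' V'| ≤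
        cR P (j + 1) s' V' * |slotsTOfRecord F N θ.ν θ.τ9 (EOfRecord₁₃ F N θ.toStage13Params) (wOfRecord₉ F N θ.toStage9Params) θ.ppSel P
          (gOfRecord₁₃ F N θ.toStage13Params P) (j + 1) s' V'|)
    (hstep : ∀ P : B12.RunParams, ((datumOfRecord₁₃CoPH F N θ h).C P).flow.InInterval γ P.K → ∀ j, j < P.K →
      ∀ (s' : SeqOfRecord F θ.ν θ.τ9.M (gOfRecord₁₃ F N θ.toStage13Params P) P.K (j + 1)) V',
      chiSeqOfRecord F N θ.ν θ.τ9.M (gOfRecord₁₃ F N θ.toStage13Params P) P.K (j + 1) s' V' * cR P (j + 1) s' V' *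
          transportOfRecord F N P.K j (fun U => |wOfRecord₉ F N θ.toStage9Params P (gOfRecord₁₃ F N θ.toStage13Params P) j s' U V'|) V' *
          Real.exp (a P j) ≤
        Real.exp (a P (j + 1)) *
          (x P (j + 1) ^ Set.ncard {c | c ∈ cubeIndices (F.P P.K) (dCubeSide (F.P P.K).L θ.τ9.M
              (RkOfRecord (F.P P.K).L θ.ν.r (gOfRecord₁₃ F N θ.toStage13Params P (j + 1))) (j + 1)) ∧
            ¬ cubeEnl (F.P P.K) (dCubeSide (F.P P.K).L θ.τ9.M (RkOfRecord (F.P P.K).L θ.ν.r (gOfRecord₁₃ F N θ.toStage13Params P (j + 1))) (j + 1)) c 0 ⊆ s'.Ω (j + 1)} *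
           y P (j + 1) ^ Set.ncard {c | c ∈ cubeIndices (F.P P.K) (dCubeSide (F.P P.K).L θ.τ9.M
              (RkOfRecord (F.P P.K).L θ.ν.r (gOfRecord₁₃ F N θ.toStage13Params P (j + 1))) (j + 1)) ∧
            ¬ cubeEnl (F.P P.K) (dCubeSide (F.P P.K).L θ.τ9.M (RkOfRecord (F.P P.K).L θ.ν.r (gOfRecord₁₃ F N θ.toStage13Params P (j + 1))) (j + 1)) c 0 ⊆ s'.Λ (j + 1)}))
    (hnum : ∀ P : B12.RunParams, ((datumOfRecord₁₃CoPH F N θ h).C P).flow.InInterval γ P.K → ∀ k, k ≤ P.K →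
      a P k + ∑ j ∈ Finset.Icc 1 k, (x P j + y P j) *
          (cubeIndices (F.P P.K) (dCubeSide (F.P P.K).L θ.τ9.M (RkOfRecord (F.P P.K).L θ.ν.r (gOfRecord₁₃ F N θ.toStage13Params P j)) j)).card
        ≤ ep (gOfRecord₁₃ F N θ.toStage13Params P k) * (Fintype.card (Site (F.P P.K) k) : ℝ))
    (s₀ : (P : B12.RunParams) → (k : ℕ) → (reprOfRecord₁₃ F N θ.toStage13Params P k).Adm)
    (h1 : B16.Thm1Printed (datumOfRecord₁₃CoPH F N θ h).C)
    (hL2small : ∀ P : B12.RunParams, ((datumOfRecord₁₃CoPH F N θ h).C P).flow.InInterval γ P.K → ∀ k, k ≤ P.K → SLaw₁₃CoPH F N θ P k →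
      ∀ V : GaugeField (F.P P.K) k (SU N),
        (∀ p : Plaq (F.P P.K) k, ¬ IsB0 (F := F) (⟨p.src, p.μ⟩ : PBond (F.P P.K) k) → ¬ IsB0 (F := F) (⟨p.src.shift p.μ, p.ν⟩ : PBond (F.P P.K) k) →
          ¬ IsB0 (F := F) (⟨p.src.shift p.ν, p.μ⟩ : PBond (F.P P.K) k) → ¬ IsB0 (F := F) (⟨p.src, p.ν⟩ : PBond (F.P P.K) k) →
          dist1 (GaugeField.plaqHol V p) < 2 * θ.ν.εreg + 4 * θ.ε₂₉) →
        chiβOfRecord₁₃ F N θ.toStage13Params P.K (gOfRecord₁₃ F N θ.toStage13Params P) k V *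
            Real.exp (-(1 / (gOfRecord₁₃ F N θ.toStage13Params P k) ^ 2 * wilsonBGOfRecord F N θ.εbg P k V)
              - em (gOfRecord₁₃ F N θ.toStage13Params P k) * (Fintype.card (Site (F.P P.K) k) : ℝ)) ≤
          (reprOfRecord₁₃ F N θ.toStage13Params P k).χ (s₀ P k) V * (reprOfRecord₁₃ F N θ.toStage13Params P k).TexpA (s₀ P k) V) :
    B16.Cor3_250 (datumOfRecord₁₃CoPH F N θ h).C := by
  obtain ⟨γ₁, hγ₁, H1⟩ := sLaw₁₃CoPH_of_thm1 F N θ h h1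
  refine ⟨min γ γ₁, lt_min hγ hγ₁, em, ep, ?_⟩
  refine cor3With_datumOfRecord₁₃CoPH_of_productStepRows_L2small F N θ h hε hε3 hε2 (min γ γ₁) em ep x y a hx hy cR h0 hcR hR ?_ ?_ s₀ ?_ ?_
  · exact fun P hP => hstep P (inInterval_of_le hP (min_le_left γ γ₁))
  · exact fun P hP => hnum P (inInterval_of_le hP (min_le_left γ γ₁))
  · exact fun P hP k hk => H1 P (inInterval_of_le hP (min_le_right γ γ₁)) k hk
  · exact fun P hP => hL2small P (inInterval_of_le hP (min_le_left γ γ₁))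

end Family

/-! ## §3. K1⁷'s LITERAL DATUM `datumOfRecord₁₃SepCoPH θ h`: (B) from Theorem 1 there, and from N11's T-row + selector laws (p583899), with the per-step rows -/

section SepCoPH

variable (θ : Stage13HParams F N) (h : θ.Provisos₁₃SepCoPH F N)

open Classical in
/-- **★★★ K1⁷'s (B) CONJUNCT AT ITS LITERAL DATUM FROM THEOREM 1 THERE + PER-STEP ROWS + (L2ˢ)** — `B16.EndStatementBPrinted ((datumOfRecord₁₃SepCoPH θ h).C)` from `B16.Thm1Printed (…)`
(a HYPOTHESIS), the tower's product rows and (L2ˢ) on `]0, γ]`; §2 at `h.toCore`.  CONDITIONAL; K1⁷ NOT closed. [cite: Balaban1989LargeFieldII, Thm 1 p.355, (0.1) pp.355–356; Balaban1988Convergent, Cor. 3 p.264] -/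
theorem endStatementBPrinted_datumOfRecord₁₃SepCoPH_of_thm1_of_productStepRows_L2small (hε : 0 < θ.ν.εreg) (hε3 : (143 * ((((4 + 4 : ℕ) : ℝ)) ^ 2 / 4) ^ 2) * θ.ν.εreg ≤ 1 / 3)
    (hε2 : 2 * θ.ν.εreg ≤ 2 * deltaSU (Fin N) / ((((4 + 4) * F.L : ℕ) : ℝ) ^ 2)) (γ : ℝ) (hγ : 0 < γ) (em ep : ℝ → ℝ)
    (x y a : B12.RunParams → ℕ → ℝ) (hx : ∀ P j, 0 ≤ x P j) (hy : ∀ P j, 0 ≤ y P j)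
    (cR : (P : B12.RunParams) → (j : ℕ) → SeqOfRecord F θ.ν θ.τ9.M (gOfRecord₁₃ F N θ.toStage13Params P) P.K j → GaugeField (F.P P.K) j (SU N) → ℝ)
    (h0 : ∀ P : B12.RunParams, -EOfRecord₁₃ F N θ.toStage13Params P ≤ a P 0)
    (hcR : ∀ (P : B12.RunParams) j, j < P.K → ∀ (s' : SeqOfRecord F θ.ν θ.τ9.M (gOfRecord₁₃ F N θ.toStage13Params P) P.K (j + 1)) V', 0 ≤ cR P (j + 1) s' V')
    (hR : ∀ (P : B12.RunParams) j, j < P.K → ∀ (s' : SeqOfRecord F θ.ν θ.τ9.M (gOfRecord₁₃ F N θ.toStage13Params P) P.K (j + 1)) V',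
      |slotsOfRecord F N θ.ν θ.τ9 (EOfRecord₁₃ F N θ.toStage13Params) (wOfRecord₉ F N θ.toStage9Params) θ.ppSel P
          (gOfRecord₁₃ F N θ.toStage13Params P) (j + 1) s' V'| ≤
        cR P (j + 1) s' V' * |slotsTOfRecord F N θ.ν θ.τ9 (EOfRecord₁₃ F N θ.toStage13Params) (wOfRecord₉ F N θ.toStage9Params) θ.ppSel P
          (gOfRecord₁₃ F N θ.toStage13Params P) (j + 1) s' V'|)
    (hstep : ∀ P : B12.RunParams, ((datumOfRecord₁₃SepCoPH F N θ h).C P).flow.InInterval γ P.K → ∀ j, j < P.K →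
      ∀ (s' : SeqOfRecord F θ.ν θ.τ9.M (gOfRecord₁₃ F N θ.toStage13Params P) P.K (j + 1)) V',
      chiSeqOfRecord F N θ.ν θ.τ9.M (gOfRecord₁₃ F N θ.toStage13Params P) P.K (j + 1) s' V' * cR P (j + 1) s' V' *
          transportOfRecord F N P.K j (fun U => |wOfRecord₉ F N θ.toStage9Params P (gOfRecord₁₃ F N θ.toStage13Params P) j s' U V'|) V' *
          Real.exp (a P j) ≤
        Real.exp (a P (j + 1)) *
          (x P (j + 1) ^ Set.ncard {c | c ∈ cubeIndices (F.P P.K) (dCubeSide (F.P P.K).L θ.τ9.M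
              (RkOfRecord (F.P P.K).L θ.ν.r (gOfRecord₁₃ F N θ.toStage13Params P (j + 1))) (j + 1)) ∧
            ¬ cubeEnl (F.P P.K) (dCubeSide (F.P P.K).L θ.τ9.M (RkOfRecord (F.P P.K).L θ.ν.r (gOfRecord₁₃ F N θ.toStage13Params P (j + 1))) (j + 1)) c 0 ⊆ s'.Ω (j + 1)} *
           y P (j + 1) ^ Set.ncard {c | c ∈ cubeIndices (F.P P.K) (dCubeSide (F.P P.K).L θ.τ9.M
              (RkOfRecord (F.P P.K).L θ.ν.r (gOfRecord₁₃ F N θ.toStage13Params P (j + 1))) (j + 1)) ∧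
            ¬ cubeEnl (F.P P.K) (dCubeSide (F.P P.K).L θ.τ9.M (RkOfRecord (F.P P.K).L θ.ν.r (gOfRecord₁₃ F N θ.toStage13Params P (j + 1))) (j + 1)) c 0 ⊆ s'.Λ (j + 1)}))
    (hnum : ∀ P : B12.RunParams, ((datumOfRecord₁₃SepCoPH F N θ h).C P).flow.InInterval γ P.K → ∀ k, k ≤ P.K →
      a P k + ∑ j ∈ Finset.Icc 1 k, (x P j + y P j) *
          (cubeIndices (F.P P.K) (dCubeSide (F.P P.K).L θ.τ9.M (RkOfRecord (F.P P.K).L θ.ν.r (gOfRecord₁₃ F N θ.toStage13Params P j)) j)).card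
        ≤ ep (gOfRecord₁₃ F N θ.toStage13Params P k) * (Fintype.card (Site (F.P P.K) k) : ℝ))
    (s₀ : (P : B12.RunParams) → (k : ℕ) → (reprOfRecord₁₃ F N θ.toStage13Params P k).Adm)
    (h1 : B16.Thm1Printed (datumOfRecord₁₃SepCoPH F N θ h).C)
    (hL2small : ∀ P : B12.RunParams, ((datumOfRecord₁₃SepCoPH F N θ h).C P).flow.InInterval γ P.K → ∀ k, k ≤ P.K → SLaw₁₃CoPH F N θ P k →
      ∀ V : GaugeField (F.P P.K) k (SU N),
        (∀ p : Plaq (F.P P.K) k, ¬ IsB0 (F := F) (⟨p.src, p.μ⟩ : PBond (F.P P.K) k) → ¬ IsB0 (F := F) (⟨p.src.shift p.μ, p.ν⟩ : PBond (F.P P.K) k) →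
          ¬ IsB0 (F := F) (⟨p.src.shift p.ν, p.μ⟩ : PBond (F.P P.K) k) → ¬ IsB0 (F := F) (⟨p.src, p.ν⟩ : PBond (F.P P.K) k) →
          dist1 (GaugeField.plaqHol V p) < 2 * θ.ν.εreg + 4 * θ.ε₂₉) →
        chiβOfRecord₁₃ F N θ.toStage13Params P.K (gOfRecord₁₃ F N θ.toStage13Params P) k V *
            Real.exp (-(1 / (gOfRecord₁₃ F N θ.toStage13Params P k) ^ 2 * wilsonBGOfRecord F N θ.εbg P k V)
              - em (gOfRecord₁₃ F N θ.toStage13Params P k) * (Fintype.card (Site (F.P P.K) k) : ℝ)) ≤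
          (reprOfRecord₁₃ F N θ.toStage13Params P k).χ (s₀ P k) V * (reprOfRecord₁₃ F N θ.toStage13Params P k).TexpA (s₀ P k) V) :
    B16.EndStatementBPrinted (datumOfRecord₁₃SepCoPH F N θ h).C :=
  ⟨h1, cor3_250_datumOfRecord₁₃CoPH_of_thm1_of_productStepRows_L2small F N θ h.toCore hε hε3 hε2 γ hγ em ep x y a hx hy cR h0 hcR hR hstep hnum s₀ h1 hL2small⟩

open Classical in
/-- **★★★ WHAT K1⁷'s (B) CONJUNCT COSTS AT ITS LITERAL DATUM AFTER THE CARVING, EVERY NODE-EXTERNAL INPUT BY NAME**: `B16.EndStatementBPrinted ((datumOfRecord₁₃SepCoPH F N θ h).C)` ⟸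
admissibility ∧ the three term-constant signs ∧ the [IV] p.177 selector laws (i) `hidem` ∕ (ii) `hdead` ∧ N11's T-ROW on `]0, γ]` (⟹ Theorem 1 at the datum, p583899) ∧ the majorant tower's
PER-STEP ROWS (base `−E(P) ≤ a_P(0)`, 𝐑-ratio rows, product-shape step rows, numeric clause) ∧ (L2ˢ) ∧ `hε hε3 hε2`.  CONDITIONAL on the displayed inputs; K1⁷ NOT closed; nothing of
Bałaban's asserted. [cite: Balaban1989LargeFieldII, Thm 1 p.355, (0.1) pp.355–356, p.391; Balaban1988Convergent, Theorem p.245, Thm 1 p.262, (2.49) + Cor. 3 p.264; Balaban1989LargeFieldI, (0.3) p.176, (i)–(ii) p.177] -/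
theorem endStatementBPrinted_datumOfRecord₁₃SepCoPH_of_tRow_selLaws_productStepRows_L2small (hθ : θ.Admissible F N) (hκ : 0 ≤ θ.s2.lf.κ) (hE₀ : 0 ≤ θ.s2.lf.E₀)
    (hB₀ : 0 ≤ θ.s2.lf.B₀) (hε : 0 < θ.ν.εreg) (hε3 : (143 * ((((4 + 4 : ℕ) : ℝ)) ^ 2 / 4) ^ 2) * θ.ν.εreg ≤ 1 / 3)
    (hε2 : 2 * θ.ν.εreg ≤ 2 * deltaSU (Fin N) / ((((4 + 4) * F.L : ℕ) : ℝ) ^ 2)) (γ : ℝ) (hγ : 0 < γ) (em ep : ℝ → ℝ)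
    (x y a : B12.RunParams → ℕ → ℝ) (hx : ∀ P j, 0 ≤ x P j) (hy : ∀ P j, 0 ≤ y P j)
    (cR : (P : B12.RunParams) → (j : ℕ) → SeqOfRecord F θ.ν θ.τ9.M (gOfRecord₁₃ F N θ.toStage13Params P) P.K j → GaugeField (F.P P.K) j (SU N) → ℝ)
    (h0 : ∀ P : B12.RunParams, -EOfRecord₁₃ F N θ.toStage13Params P ≤ a P 0)
    (hcR : ∀ (P : B12.RunParams) j, j < P.K → ∀ (s' : SeqOfRecord F θ.ν θ.τ9.M (gOfRecord₁₃ F N θ.toStage13Params P) P.K (j + 1)) V', 0 ≤ cR P (j + 1) s' V')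
    (hR : ∀ (P : B12.RunParams) j, j < P.K → ∀ (s' : SeqOfRecord F θ.ν θ.τ9.M (gOfRecord₁₃ F N θ.toStage13Params P) P.K (j + 1)) V',
      |slotsOfRecord F N θ.ν θ.τ9 (EOfRecord₁₃ F N θ.toStage13Params) (wOfRecord₉ F N θ.toStage9Params) θ.ppSel P
          (gOfRecord₁₃ F N θ.toStage13Params P) (j + 1) s' V'| ≤
        cR P (j + 1) s' V' * |slotsTOfRecord F N θ.ν θ.τ9 (EOfRecord₁₃ F N θ.toStage13Params) (wOfRecord₉ F N θ.toStage9Params) θ.ppSel P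
          (gOfRecord₁₃ F N θ.toStage13Params P) (j + 1) s' V'|)
    (hstep : ∀ P : B12.RunParams, ((datumOfRecord₁₃SepCoPH F N θ h).C P).flow.InInterval γ P.K → ∀ j, j < P.K →
      ∀ (s' : SeqOfRecord F θ.ν θ.τ9.M (gOfRecord₁₃ F N θ.toStage13Params P) P.K (j + 1)) V',
      chiSeqOfRecord F N θ.ν θ.τ9.M (gOfRecord₁₃ F N θ.toStage13Params P) P.K (j + 1) s' V' * cR P (j + 1) s' V' *
          transportOfRecord F N P.K j (fun U => |wOfRecord₉ F N θ.toStage9Params P (gOfRecord₁₃ F N θ.toStage13Params P) j s' U V'|) V' *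
          Real.exp (a P j) ≤
        Real.exp (a P (j + 1)) *
          (x P (j + 1) ^ Set.ncard {c | c ∈ cubeIndices (F.P P.K) (dCubeSide (F.P P.K).L θ.τ9.M
              (RkOfRecord (F.P P.K).L θ.ν.r (gOfRecord₁₃ F N θ.toStage13Params P (j + 1))) (j + 1)) ∧
            ¬ cubeEnl (F.P P.K) (dCubeSide (F.P P.K).L θ.τ9.M (RkOfRecord (F.P P.K).L θ.ν.r (gOfRecord₁₃ F N θ.toStage13Params P (j + 1))) (j + 1)) c 0 ⊆ s'.Ω (j + 1)} *
           y P (j + 1) ^ Set.ncard {c | c ∈ cubeIndices (F.P P.K) (dCubeSide (F.P P.K).L θ.τ9.M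
              (RkOfRecord (F.P P.K).L θ.ν.r (gOfRecord₁₃ F N θ.toStage13Params P (j + 1))) (j + 1)) ∧
            ¬ cubeEnl (F.P P.K) (dCubeSide (F.P P.K).L θ.τ9.M (RkOfRecord (F.P P.K).L θ.ν.r (gOfRecord₁₃ F N θ.toStage13Params P (j + 1))) (j + 1)) c 0 ⊆ s'.Λ (j + 1)}))
    (hnum : ∀ P : B12.RunParams, ((datumOfRecord₁₃SepCoPH F N θ h).C P).flow.InInterval γ P.K → ∀ k, k ≤ P.K →
      a P k + ∑ j ∈ Finset.Icc 1 k, (x P j + y P j) *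
          (cubeIndices (F.P P.K) (dCubeSide (F.P P.K).L θ.τ9.M (RkOfRecord (F.P P.K).L θ.ν.r (gOfRecord₁₃ F N θ.toStage13Params P j)) j)).card
        ≤ ep (gOfRecord₁₃ F N θ.toStage13Params P k) * (Fintype.card (Site (F.P P.K) k) : ℝ))
    (s₀ : (P : B12.RunParams) → (k : ℕ) → (reprOfRecord₁₃ F N θ.toStage13Params P k).Adm)
    (hidem : ∀ (P : B12.RunParams) k, k < P.K → ∀ a, θ.ppSel P (gOfRecord₁₃ F N θ.toStage13Params P) (k + 1) (θ.ppSel P (gOfRecord₁₃ F N θ.toStage13Params P) (k + 1) a)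
      = θ.ppSel P (gOfRecord₁₃ F N θ.toStage13Params P) (k + 1) a)
    (hdead : ∀ (P : B12.RunParams) k, k < P.K → ∀ a, θ.ppSel P (gOfRecord₁₃ F N θ.toStage13Params P) (k + 1) a ≠ a →
      ∀ V, B15.BasicStep.fibreIntegral (fibOfSeq F θ.ν θ.τ9 P (gOfRecord₁₃ F N θ.toStage13Params P) (k + 1) a)
        (rterm (sliceOfRecord F N θ.ν θ.τ9.M P (gOfRecord₁₃ F N θ.toStage13Params P) (k + 1)
          (slotsTOfRecord F N θ.ν θ.τ9 (EOfRecord₁₃ F N θ.toStage13Params) (wOfRecord₉ F N θ.toStage9Params) θ.ppSel P (gOfRecord₁₃ F N θ.toStage13Params P) (k + 1))) a) V = 0)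
    (hT : ∀ P : B12.RunParams, ((datumOfRecord₁₃SepCoPH F N θ h).C P).flow.InInterval γ P.K →
      ∀ k, k < P.K → SLaw₁₃CoPH F N θ P k → TLaw₁₃CoPH F N θ P k)
    (hL2small : ∀ P : B12.RunParams, ((datumOfRecord₁₃SepCoPH F N θ h).C P).flow.InInterval γ P.K → ∀ k, k ≤ P.K → SLaw₁₃CoPH F N θ P k →
      ∀ V : GaugeField (F.P P.K) k (SU N),
        (∀ p : Plaq (F.P P.K) k, ¬ IsB0 (F := F) (⟨p.src, p.μ⟩ : PBond (F.P P.K) k) → ¬ IsB0 (F := F) (⟨p.src.shift p.μ, p.ν⟩ : PBond (F.P P.K) k) →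
          ¬ IsB0 (F := F) (⟨p.src.shift p.ν, p.μ⟩ : PBond (F.P P.K) k) → ¬ IsB0 (F := F) (⟨p.src, p.ν⟩ : PBond (F.P P.K) k) →
          dist1 (GaugeField.plaqHol V p) < 2 * θ.ν.εreg + 4 * θ.ε₂₉) →
        chiβOfRecord₁₃ F N θ.toStage13Params P.K (gOfRecord₁₃ F N θ.toStage13Params P) k V *
            Real.exp (-(1 / (gOfRecord₁₃ F N θ.toStage13Params P k) ^ 2 * wilsonBGOfRecord F N θ.εbg P k V)
              - em (gOfRecord₁₃ F N θ.toStage13Params P k) * (Fintype.card (Site (F.P P.K) k) : ℝ)) ≤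
          (reprOfRecord₁₃ F N θ.toStage13Params P k).χ (s₀ P k) V * (reprOfRecord₁₃ F N θ.toStage13Params P k).TexpA (s₀ P k) V) :
    B16.EndStatementBPrinted (datumOfRecord₁₃SepCoPH F N θ h).C :=
  endStatementBPrinted_datumOfRecord₁₃SepCoPH_of_thm1_of_productStepRows_L2small F N θ h hε hε3 hε2 γ hγ em ep x y a hx hy cR h0 hcR hR hstep hnum s₀
    (thm1Printed_datumOfRecord₁₃SepCoPH_of_laws_of_selLaws F N θ h hθ hκ hE₀ hB₀ hγ hidem hdead hT) hL2small

end SepCoPH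

/-! ## §4. N13's DAG NODE `Dag.B16_main (leavesP w P)` — the N13 entry of K1⁷ v6 stub 1's `Nodes (leavesP w P)` — from the selector laws + the per-step rows + (L2ˢ) -/

section Node

variable (θ : Stage13HParams F N) (w : WorldP) (P : B12.RunParams) (h : θ.Provisos₁₃CoPH F N)

open Classical in
/-- **★★★ N13's NODE PREDICATE AT A WORLD BOUND TO THE STAGE-13 RECORD, AFTER THE CARVING** (the per-step twin of F3's `b16_main_at_record₁₃CoPH_of_selLaws_pieceBounds_L2small`): for
`w.C = (datumOfRecord₁₃CoPH θ h).C` and `w.up P = upOfRecord₅C … P`, `Dag.B16_main (leavesP w P)` (module 36's `b16_main_at_record₁₃CoPH`) with (R₁₃) SUPPLIED by p583899's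
`laws₁₃CoPH_of_selLaws_coPH` (admissibility, signs, selector laws (i)(ii)) and (UV₁₃) SUPPLIED by §1 at `γ₁ := w.γ` — i.e. by the base weight `ρ₀` (discharged), the PER-STEP transported-step-weight
× 𝐑-ratio rows in product shape with their numeric clause, and (L2ˢ).  This is the N13 conjunct of `Nodes (leavesP w P)` in K1⁷ v6 `stub_nodes13PWS`, priced per step: [B16] Thm 1's bounds enter
ONLY through the step rows ((2.49) first term ∕ (1.89)) and the 𝐑-ratio rows ([IV] §1), [III] Thm 2 only through (L2ˢ).  CONDITIONAL on the displayed inputs; N13 NOT discharged; nothing of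
Bałaban's asserted. [cite: Balaban1989LargeFieldII, Thm 1 p.355, (0.1) pp.355–356, (1.89) p.387; Balaban1988Convergent, p.244, (2.49) + Cor. 3 p.264; Balaban1989LargeFieldI, (0.3) p.176, (i)–(ii) p.177] -/
theorem b16_main_at_record₁₃CoPH_of_selLaws_productStepRows_L2small (hC : w.C = (datumOfRecord₁₃CoPH F N θ h).C)
    (hup : w.up P = upOfRecord₅C F N (θ.toStage5₁₃CoPH F N) P) (hθ : θ.Admissible F N) (hκ : 0 ≤ θ.s2.lf.κ) (hE₀ : 0 ≤ θ.s2.lf.E₀) (hB₀ : 0 ≤ θ.s2.lf.B₀)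
    (hidem : ∀ k, k < P.K → ∀ a, θ.ppSel P (gOfRecord₁₃ F N θ.toStage13Params P) (k + 1) (θ.ppSel P (gOfRecord₁₃ F N θ.toStage13Params P) (k + 1) a)
      = θ.ppSel P (gOfRecord₁₃ F N θ.toStage13Params P) (k + 1) a)
    (hdead : ∀ k, k < P.K → ∀ a, θ.ppSel P (gOfRecord₁₃ F N θ.toStage13Params P) (k + 1) a ≠ a →
      ∀ V, B15.BasicStep.fibreIntegral (fibOfSeq F θ.ν θ.τ9 P (gOfRecord₁₃ F N θ.toStage13Params P) (k + 1) a)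
        (rterm (sliceOfRecord F N θ.ν θ.τ9.M P (gOfRecord₁₃ F N θ.toStage13Params P) (k + 1)
          (slotsTOfRecord F N θ.ν θ.τ9 (EOfRecord₁₃ F N θ.toStage13Params) (wOfRecord₉ F N θ.toStage9Params) θ.ppSel P (gOfRecord₁₃ F N θ.toStage13Params P) (k + 1))) a) V = 0)
    (hε : 0 < θ.ν.εreg) (hε3 : (143 * ((((4 + 4 : ℕ) : ℝ)) ^ 2 / 4) ^ 2) * θ.ν.εreg ≤ 1 / 3)
    (hε2 : 2 * θ.ν.εreg ≤ 2 * deltaSU (Fin N) / ((((4 + 4) * F.L : ℕ) : ℝ) ^ 2))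
    (x y a : B12.RunParams → ℕ → ℝ) (hx : ∀ P j, 0 ≤ x P j) (hy : ∀ P j, 0 ≤ y P j)
    (cR : (P : B12.RunParams) → (j : ℕ) → SeqOfRecord F θ.ν θ.τ9.M (gOfRecord₁₃ F N θ.toStage13Params P) P.K j → GaugeField (F.P P.K) j (SU N) → ℝ)
    (h0 : ∀ P : B12.RunParams, -EOfRecord₁₃ F N θ.toStage13Params P ≤ a P 0)
    (hcR : ∀ (P : B12.RunParams) j, j < P.K → ∀ (s' : SeqOfRecord F θ.ν θ.τ9.M (gOfRecord₁₃ F N θ.toStage13Params P) P.K (j + 1)) V', 0 ≤ cR P (j + 1) s' V')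
    (hR : ∀ (P : B12.RunParams) j, j < P.K → ∀ (s' : SeqOfRecord F θ.ν θ.τ9.M (gOfRecord₁₃ F N θ.toStage13Params P) P.K (j + 1)) V',
      |slotsOfRecord F N θ.ν θ.τ9 (EOfRecord₁₃ F N θ.toStage13Params) (wOfRecord₉ F N θ.toStage9Params) θ.ppSel P
          (gOfRecord₁₃ F N θ.toStage13Params P) (j + 1) s' V'| ≤
        cR P (j + 1) s' V' * |slotsTOfRecord F N θ.ν θ.τ9 (EOfRecord₁₃ F N θ.toStage13Params) (wOfRecord₉ F N θ.toStage9Params) θ.ppSel P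
          (gOfRecord₁₃ F N θ.toStage13Params P) (j + 1) s' V'|)
    (hstep : ∀ P : B12.RunParams, (genFlow (betaOfRecord₁₃ F N θ.toStage13Params) P.g0).InInterval w.γ P.K → ∀ j, j < P.K →
      ∀ (s' : SeqOfRecord F θ.ν θ.τ9.M (gOfRecord₁₃ F N θ.toStage13Params P) P.K (j + 1)) V',
      chiSeqOfRecord F N θ.ν θ.τ9.M (gOfRecord₁₃ F N θ.toStage13Params P) P.K (j + 1) s' V' * cR P (j + 1) s' V' *
          transportOfRecord F N P.K j (fun U => |wOfRecord₉ F N θ.toStage9Params P (gOfRecord₁₃ F N θ.toStage13Params P) j s' U V'|) V' *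
          Real.exp (a P j) ≤
        Real.exp (a P (j + 1)) *
          (x P (j + 1) ^ Set.ncard {c | c ∈ cubeIndices (F.P P.K) (dCubeSide (F.P P.K).L θ.τ9.M
              (RkOfRecord (F.P P.K).L θ.ν.r (gOfRecord₁₃ F N θ.toStage13Params P (j + 1))) (j + 1)) ∧
            ¬ cubeEnl (F.P P.K) (dCubeSide (F.P P.K).L θ.τ9.M (RkOfRecord (F.P P.K).L θ.ν.r (gOfRecord₁₃ F N θ.toStage13Params P (j + 1))) (j + 1)) c 0 ⊆ s'.Ω (j + 1)} *
           y P (j + 1) ^ Set.ncard {c | c ∈ cubeIndices (F.P P.K) (dCubeSide (F.P P.K).L θ.τ9.M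
              (RkOfRecord (F.P P.K).L θ.ν.r (gOfRecord₁₃ F N θ.toStage13Params P (j + 1))) (j + 1)) ∧
            ¬ cubeEnl (F.P P.K) (dCubeSide (F.P P.K).L θ.τ9.M (RkOfRecord (F.P P.K).L θ.ν.r (gOfRecord₁₃ F N θ.toStage13Params P (j + 1))) (j + 1)) c 0 ⊆ s'.Λ (j + 1)}))
    (hnum : ∀ P : B12.RunParams, (genFlow (betaOfRecord₁₃ F N θ.toStage13Params) P.g0).InInterval w.γ P.K → ∀ k, k ≤ P.K →
      a P k + ∑ j ∈ Finset.Icc 1 k, (x P j + y P j) *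
          (cubeIndices (F.P P.K) (dCubeSide (F.P P.K).L θ.τ9.M (RkOfRecord (F.P P.K).L θ.ν.r (gOfRecord₁₃ F N θ.toStage13Params P j)) j)).card
        ≤ w.ep (gOfRecord₁₃ F N θ.toStage13Params P k) * (Fintype.card (Site (F.P P.K) k) : ℝ))
    (s₀ : (P : B12.RunParams) → (k : ℕ) → (reprOfRecord₁₃ F N θ.toStage13Params P k).Adm)
    (hL2small : ∀ P : B12.RunParams, (genFlow (betaOfRecord₁₃ F N θ.toStage13Params) P.g0).InInterval w.γ P.K → ∀ k, k ≤ P.K → SLaw₁₃CoPH F N θ P k →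
      ∀ V : GaugeField (F.P P.K) k (SU N),
        (∀ p : Plaq (F.P P.K) k, ¬ IsB0 (F := F) (⟨p.src, p.μ⟩ : PBond (F.P P.K) k) → ¬ IsB0 (F := F) (⟨p.src.shift p.μ, p.ν⟩ : PBond (F.P P.K) k) →
          ¬ IsB0 (F := F) (⟨p.src.shift p.ν, p.μ⟩ : PBond (F.P P.K) k) → ¬ IsB0 (F := F) (⟨p.src, p.ν⟩ : PBond (F.P P.K) k) →
          dist1 (GaugeField.plaqHol V p) < 2 * θ.ν.εreg + 4 * θ.ε₂₉) →
        chiβOfRecord₁₃ F N θ.toStage13Params P.K (gOfRecord₁₃ F N θ.toStage13Params P) k V *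
            Real.exp (-(1 / (gOfRecord₁₃ F N θ.toStage13Params P k) ^ 2 * wilsonBGOfRecord F N θ.εbg P k V)
              - w.em (gOfRecord₁₃ F N θ.toStage13Params P k) * (Fintype.card (Site (F.P P.K) k) : ℝ)) ≤
          (reprOfRecord₁₃ F N θ.toStage13Params P k).χ (s₀ P k) V * (reprOfRecord₁₃ F N θ.toStage13Params P k).TexpA (s₀ P k) V) :
    Dag.B16_main (DagBinding.leavesP w P) :=
  B16NodeKnitRecord13CoPH.b16_main_at_record₁₃CoPH F N θ w P h hC hup
    (B16RLeafRecord13SepCoPHSelLaws.laws₁₃CoPH_of_selLaws_coPH F N θ P h hθ hκ hE₀ hB₀ hidem hdead) le_rfl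
    (hUV₁₃CoPH_of_productStepRows_L2small F N θ w h hε hε3 hε2 x y a hx hy cR h0 hcR hR hstep hnum s₀ hL2small P)

end Node

end Summit.QuantumFields.YangMills.BalabanUVNodes.N13NodeOfProductStepRowsAtRecord13SepCoPH

end
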